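import Summits.KontsevichZagierPeriods.KontsevichZagierPeriods.Theses.SymplecticScissors

/-! # DrefuteScratch — refuter (drefute) Lean by-products for line `twist-restoring-shear` of crux `PlanarCompiler`
(stmt-KontsevichZagierPeriods-10058; lead's reshaped skeleton a84852d9, `Lines/twist-restoring-shear.lean`).
`lean check` rc 0, 0 sorry, 0 warnings; axioms ⊆ {propext, Classical.choice, Quot.sound}. Imports only the route file.

Contents (candidate proofs for the lead — positive lemmas are not landable by a refuter):
* `sub_mem_cov_of_domain_eq_of_eqOn` — any dimension: same domain + integrands agreeing on it ⇒ ONE rule-2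
  instance `Φ = id` (the telescoping `ρlo j` / `ρhi i` step of `stub_greenAssembly`; flat cells of `stub_band`);
* `sub_mem_cov_of_domain_empty` — empty domains ⇒ rule-2 instance (engine `stub_shearedTransport` at `U = ∅`
  is not junk-false);
* `isOpen_cell` — the cell `{t ∈ (a,b), lo t < y < hi t}` is open from `ContinuousOn lo/hi (Icc a b)` (NOT among
  `stub_band`'s hypotheses, needed to read `fderiv ℝ F p` honestly);
* `fibre_subset_triangle` — closed vertical fibres of a cell `C ⊆ T` lie in the closed triangle;
* `trace_eq_of_flat`, `band_flat` — the `ε = 0` case of `stub_band`, PROVED in the stub's binder shape;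
* `image_cell_eq_of_pos` / `image_cell_eq_of_neg` — the geometric heart of the `ε = ±1` cases:
  `Ψ_F(C)` is EXACTLY the open region between the two trace graphs. -/

noncomputable section

open MeasureTheory Set
open Literature.NumberTheory.Transcendental Literature.ModelTheory.ExponentialFields
open Summit.KontsevichZagierPeriods.KontsevichZagierPeriods.Theses.SymplecticScissors

namespace DrefuteScratch

/-- Same domain, integrands agreeing on it (any dimension, any integrand): ONE rule-2 instance, `Φ = id`.
(Dimension-1 use: the telescoping `ρlo j` vs `ρhi i` of stub_greenAssembly and the flat case of stub_band.) -/
theorem sub_mem_cov_of_domain_eq_of_eqOn {n : ℕ} {r r' : KZ.IntegralRep n}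
    (hdom : r.domain = r'.domain) (hint : EqOn r.integrand r'.integrand r.domain) :
    KZ.of r - KZ.of r' ∈ KZ.changeOfVariablesRel := by
  refine ⟨n, r, r', id, fun _ => ContinuousLinearMap.id ℝ (Fin n → ℝ),
    isSemialgebraicMapOn_id r.isSemialgebraic_domain,
    fun x _ => (ContinuousLinearMap.id ℝ (Fin n → ℝ)).hasFDerivWithinAt, injOn_id _,
    by rw [image_id, hdom], fun x hx => ?_, rfl⟩
  have : (ContinuousLinearMap.id ℝ (Fin n → ℝ)).det = 1 := by
    show LinearMap.det ((ContinuousLinearMap.id ℝ (Fin n → ℝ) : (Fin n → ℝ) →ₗ[ℝ] (Fin n → ℝ))) = 1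
    rw [ContinuousLinearMap.coe_id, LinearMap.det_id]
  rw [this, hint hx]
  simp

/-- Junk corner of the engine (`U = ∅`) and of empty images: two representations with EMPTY domains differ
by a rule-2 instance (so stub_shearedTransport is not junk-false at `U = ∅`). -/
theorem sub_mem_cov_of_domain_empty {n : ℕ} {r r' : KZ.IntegralRep n}
    (h : r.domain = ∅) (h' : r'.domain = ∅) : KZ.of r - KZ.of r' ∈ KZ.changeOfVariablesRel := by
  refine ⟨n, r, r', id, fun _ => ContinuousLinearMap.id ℝ (Fin n → ℝ),
    isSemialgebraicMapOn_id r.isSemialgebraic_domain, fun x hx => ?_, injOn_id _, ?_,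
    fun x hx => ?_, rfl⟩
  · simp [h] at hx
  · rw [image_id, h, h']
  · simp [h] at hx

/-- The engine stub at `U = ∅` (all hypotheses trivially true there) holds. -/
example (A B : (Fin 2 → ℝ) → ℝ) (r r' : KZ.IntegralRep 2)
    (hr : r.domain = (fun p : Fin 2 → ℝ => (![p 0, A p] : Fin 2 → ℝ)) '' ∅)
    (hr' : r'.domain = (fun p : Fin 2 → ℝ => (![p 1, B p] : Fin 2 → ℝ)) '' ∅) :
    KZ.of r - KZ.of r' ∈ KZ.changeOfVariablesRel :=
  sub_mem_cov_of_domain_empty (by simpa using hr) (by simpa using hr')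

/-! ### The cell of stub_band / stub_signedSweep is open (not among stub_band's hypotheses; needed to
read `fderiv` honestly). -/

theorem isOpen_cell {a b : ℝ} {lo hi : ℝ → ℝ}
    (hlo : ContinuousOn lo (Icc a b)) (hhi : ContinuousOn hi (Icc a b)) :
    IsOpen {p : Fin 2 → ℝ | p 0 ∈ Ioo a b ∧ lo (p 0) < p 1 ∧ p 1 < hi (p 0)} := by
  have hV : IsOpen {p : Fin 2 → ℝ | p 0 ∈ Ioo a b} := isOpen_Ioo.preimage (continuous_apply 0)
  have hlo' : ContinuousOn (fun p : Fin 2 → ℝ => p 1 - lo (p 0)) {p | p 0 ∈ Ioo a b} :=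
    ((continuous_apply 1).continuousOn).sub
      ((hlo.mono Ioo_subset_Icc_self).comp (continuous_apply 0).continuousOn fun p hp => hp)
  have hhi0 : ContinuousOn (fun p : Fin 2 → ℝ => hi (p 0)) {p | p 0 ∈ Ioo a b} :=
    (hhi.mono Ioo_subset_Icc_self).comp (continuous_apply 0).continuousOn fun p hp => hp
  have hhi' : ContinuousOn (fun p : Fin 2 → ℝ => hi (p 0) - p 1) {p | p 0 ∈ Ioo a b} :=
    hhi0.sub (continuous_apply 1).continuousOn
  have h1 := hlo'.isOpen_inter_preimage hV isOpen_Ioi (t := Ioi (0 : ℝ))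
  have h2 := hhi'.isOpen_inter_preimage hV isOpen_Ioi (t := Ioi (0 : ℝ))
  have : {p : Fin 2 → ℝ | p 0 ∈ Ioo a b ∧ lo (p 0) < p 1 ∧ p 1 < hi (p 0)} =
      ({p : Fin 2 → ℝ | p 0 ∈ Ioo a b} ∩ (fun p : Fin 2 → ℝ => p 1 - lo (p 0)) ⁻¹' Ioi 0) ∩
      ({p : Fin 2 → ℝ | p 0 ∈ Ioo a b} ∩ (fun p : Fin 2 → ℝ => hi (p 0) - p 1) ⁻¹' Ioi 0) := by
    ext p
    simp only [mem_setOf_eq, mem_inter_iff, mem_preimage, mem_Ioi, sub_pos]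
    tauto
  rw [this]
  exact h1.inter h2

/-! ### The flat case (`ε = 0`) of stub_band, proved: the two traces coincide, so the conclusion is
`Θ` of a dimension-1 rule-2 instance (`Φ = id`). -/

/-- The closed standard triangle. -/
def Δc : Set (Fin 2 → ℝ) := {p : Fin 2 → ℝ | 0 ≤ p 0 ∧ 0 ≤ p 1 ∧ p 0 + p 1 ≤ 1}
/-- The open standard triangle. -/
def To : Set (Fin 2 → ℝ) := {p : Fin 2 → ℝ | 0 < p 0 ∧ 0 < p 1 ∧ p 0 + p 1 < 1}

/-- The closed vertical fibre of a cell of the open triangle lies in the closed triangle. -/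
theorem fibre_subset_triangle {a b : ℝ} {lo hi : ℝ → ℝ} {C : Set (Fin 2 → ℝ)}
    (hC : C = {p : Fin 2 → ℝ | p 0 ∈ Ioo a b ∧ lo (p 0) < p 1 ∧ p 1 < hi (p 0)})
    (hCT : C ⊆ To) (hlohi : ∀ t ∈ Ioo a b, lo t < hi t) {t : ℝ} (ht : t ∈ Ioo a b) {y : ℝ}
    (hy : y ∈ Icc (lo t) (hi t)) : (![t, y] : Fin 2 → ℝ) ∈ Δc := by
  have hmem : ∀ y ∈ Ioo (lo t) (hi t), (![t, y] : Fin 2 → ℝ) ∈ C := fun y hy => by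
    rw [hC]; exact ⟨by simpa using ht, by simpa using hy.1, by simpa using hy.2⟩
  have hlt := hlohi t ht
  have hTm := hCT (hmem ((lo t + hi t) / 2) ⟨by linarith, by linarith⟩)
  simp only [To, mem_setOf_eq, Matrix.cons_val_zero, Matrix.cons_val_one,
    Matrix.cons_val_fin_one] at hTm
  have hlo0 : 0 ≤ lo t := by
    by_contra hneg
    push Not at hneg
    have h1 : lo t < min (hi t) 0 := lt_min hlt hneg
    have hmin0 : min (hi t) 0 ≤ 0 := min_le_right _ _
    have hminh : min (hi t) 0 ≤ hi t := min_le_left _ _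
    have := hCT (hmem ((lo t + min (hi t) 0) / 2) ⟨by linarith, by linarith⟩)
    simp only [To, mem_setOf_eq, Matrix.cons_val_zero, Matrix.cons_val_one,
      Matrix.cons_val_fin_one] at this
    linarith [this.2.1]
  have hhi1 : t + hi t ≤ 1 := by
    by_contra hneg
    push Not at hneg
    have h1 : max (lo t) (1 - t) < hi t := max_lt hlt (by linarith)
    have hmax1 : 1 - t ≤ max (lo t) (1 - t) := le_max_right _ _
    have hmaxl : lo t ≤ max (lo t) (1 - t) := le_max_left _ _
    have := hCT (hmem ((max (lo t) (1 - t) + hi t) / 2) ⟨by linarith, by linarith⟩)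
    simp only [To, mem_setOf_eq, Matrix.cons_val_zero, Matrix.cons_val_one,
      Matrix.cons_val_fin_one] at this
    linarith [this.2.2]
  simp only [Δc, mem_setOf_eq, Matrix.cons_val_zero, Matrix.cons_val_one,
    Matrix.cons_val_fin_one]
  exact ⟨hTm.1.le, hlo0.trans hy.1, by linarith [hy.2]⟩

theorem continuous_vecCons_snd (t : ℝ) : Continuous fun y : ℝ => (![t, y] : Fin 2 → ℝ) := by
  refine continuous_pi fun i => ?_
  fin_cases i <;> simp <;> fun_prop

theorem vecCons_eq_add_smul (t y : ℝ) :
    (![t, y] : Fin 2 → ℝ) = ![t, 0] + y • (Pi.single 1 1 : Fin 2 → ℝ) := by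
  ext i; fin_cases i <;> simp

theorem hasDerivAt_vecCons_snd (t y : ℝ) :
    HasDerivAt (fun y : ℝ => (![t, y] : Fin 2 → ℝ)) (Pi.single 1 1 : Fin 2 → ℝ) y := by
  have hfun : (fun y : ℝ => (![t, y] : Fin 2 → ℝ)) =
      fun y => (![t, 0] : Fin 2 → ℝ) + y • (Pi.single 1 1 : Fin 2 → ℝ) :=
    funext (vecCons_eq_add_smul t)
  rw [hfun]
  have h := ((hasDerivAt_id y).smul_const (Pi.single 1 1 : Fin 2 → ℝ)).const_add (![t, 0] : Fin 2 → ℝ)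
  simpa using h

/-- On a flat cell the upper and lower `F`-traces coincide (constancy on the open fibre by the mean value
theorem, endpoints by continuity of `F` on the closed triangle). -/
theorem trace_eq_of_flat {F : (Fin 2 → ℝ) → ℝ} {a b : ℝ} {lo hi : ℝ → ℝ} {C : Set (Fin 2 → ℝ)}
    (hFc : ContinuousOn F Δc) (hlo : ContinuousOn lo (Icc a b)) (hhi : ContinuousOn hi (Icc a b))
    (hlohi : ∀ t ∈ Ioo a b, lo t < hi t)
    (hC : C = {p : Fin 2 → ℝ | p 0 ∈ Ioo a b ∧ lo (p 0) < p 1 ∧ p 1 < hi (p 0)})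
    (hCT : C ⊆ To) (hF1 : ContDiffOn ℝ 1 F C)
    (hflat : ∀ p ∈ C, fderiv ℝ F p (Pi.single 1 1) = 0) {t : ℝ} (ht : t ∈ Ioo a b) :
    F ![t, hi t] = F ![t, lo t] := by
  set g : ℝ → ℝ := fun y => F ![t, y] with hg
  have hCo : IsOpen C := by rw [hC]; exact isOpen_cell hlo hhi
  have hmem : ∀ y ∈ Ioo (lo t) (hi t), (![t, y] : Fin 2 → ℝ) ∈ C := fun y hy => by
    rw [hC]; exact ⟨by simpa using ht, by simpa using hy.1, by simpa using hy.2⟩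
  have hcont : ContinuousOn g (Icc (lo t) (hi t)) :=
    hFc.comp (continuous_vecCons_snd t).continuousOn
      fun y hy => fibre_subset_triangle hC hCT hlohi ht hy
  have hderiv : ∀ y ∈ Ioo (lo t) (hi t), HasDerivAt g ((fun _ => (0 : ℝ)) y) y := by
    intro y hy
    have hp := hmem y hy
    have hdiff : DifferentiableAt ℝ F ![t, y] :=
      (hF1.differentiableOn one_ne_zero).differentiableAt (hCo.mem_nhds hp)
    have h := hdiff.hasFDerivAt.comp_hasDerivAt y (hasDerivAt_vecCons_snd t y)
    rw [hflat _ hp] at h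
    exact h
  obtain ⟨c, -, hc⟩ := exists_hasDerivAt_eq_slope g (fun _ => (0 : ℝ)) (hlohi t ht) hcont hderiv
  have hne : hi t - lo t ≠ 0 := sub_ne_zero.mpr (hlohi t ht).ne'
  have : g (hi t) - g (lo t) = 0 := by
    have h0 : (g (hi t) - g (lo t)) / (hi t - lo t) = 0 := hc.symm
    rcases div_eq_zero_iff.mp h0 with h | h
    · exact h
    · exact absurd h hne
  simpa [hg, sub_eq_zero] using this

/-- **Flat case of `stub_band` (ε = 0), proved** in the stub's own shape (only the hypotheses used are kept;
`Θ`'s defining property is not even needed, only that `Θ` kills rule-2 instances in dimension 1). -/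
theorem band_flat (Θ : KZ.FormalRep →+ KZ.FormalRep)
    (hmoves : ∀ x ∈ KZ.domainAddRel ∪ KZ.integrandAddRel ∪ KZ.changeOfVariablesRel, Θ x ∈ AddSubgroup.closure ((KZ.domainAddRel ∪ KZ.changeOfVariablesRel) ∩ (AddSubgroup.closure {x : KZ.FormalRep | ∃ s : KZ.IntegralRep 2, (∀ p ∈ s.domain, s.integrand p = 1) ∧ x = KZ.of s} : Set KZ.FormalRep)))
    (F : (Fin 2 → ℝ) → ℝ) (a b : ℝ) (lo hi : ℝ → ℝ) (C : Set (Fin 2 → ℝ))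
    (hFc : ContinuousOn F {p : Fin 2 → ℝ | 0 ≤ p 0 ∧ 0 ≤ p 1 ∧ p 0 + p 1 ≤ 1})
    (hlo : ContinuousOn lo (Set.Icc a b)) (hhi : ContinuousOn hi (Set.Icc a b))
    (hlohi : ∀ t ∈ Set.Ioo a b, lo t < hi t)
    (hC : C = {p : Fin 2 → ℝ | p 0 ∈ Set.Ioo a b ∧ lo (p 0) < p 1 ∧ p 1 < hi (p 0)})
    (hCT : C ⊆ {p : Fin 2 → ℝ | 0 < p 0 ∧ 0 < p 1 ∧ p 0 + p 1 < 1}) (hF1 : ContDiffOn ℝ 1 F C)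
    (hflat : ∀ p ∈ C, fderiv ℝ F p (Pi.single 1 1) = 0)
    (r : KZ.IntegralRep 2) (ρlo ρhi : KZ.IntegralRep 1)
    (hdlo : ρlo.domain = {z : Fin 1 → ℝ | z 0 ∈ Set.Ioo a b})
    (hdhi : ρhi.domain = {z : Fin 1 → ℝ | z 0 ∈ Set.Ioo a b})
    (hilo : ∀ z ∈ ρlo.domain, ρlo.integrand z = F ![z 0, lo (z 0)])
    (hihi : ∀ z ∈ ρhi.domain, ρhi.integrand z = F ![z 0, hi (z 0)]) :
    (0 : ℤ) • KZ.of r - (Θ (KZ.of ρhi) - Θ (KZ.of ρlo)) ∈ AddSubgroup.closure ((KZ.domainAddRel ∪ KZ.changeOfVariablesRel) ∩ (AddSubgroup.closure {x : KZ.FormalRep | ∃ s : KZ.IntegralRep 2, (∀ p ∈ s.domain, s.integrand p = 1) ∧ x = KZ.of s} : Set KZ.FormalRep)) := by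
  rw [zero_smul, zero_sub, neg_mem_iff, ← map_sub]
  refine hmoves _ (Or.inr (sub_mem_cov_of_domain_eq_of_eqOn (hdhi.trans hdlo.symm) fun z hz => ?_))
  have hz' : z 0 ∈ Ioo a b := by rw [hdhi] at hz; exact hz
  rw [hihi z hz, hilo z (by rw [hdlo]; exact hz')]
  exact trace_eq_of_flat (C := C) hFc hlo hhi hlohi hC hCT hF1 hflat hz'

/-! ### Geometric heart of the `ε = ±1` cases of stub_band: the sheared image of the cell IS the region
strictly between the two trace graphs. -/

/-- Restriction of `F` to the vertical fibre over `t` has derivative `∂_yF` at interior points of the cell. -/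
theorem hasDerivAt_fibre {F : (Fin 2 → ℝ) → ℝ} {a b : ℝ} {lo hi : ℝ → ℝ} {C : Set (Fin 2 → ℝ)}
    (hlo : ContinuousOn lo (Icc a b)) (hhi : ContinuousOn hi (Icc a b))
    (hC : C = {p : Fin 2 → ℝ | p 0 ∈ Ioo a b ∧ lo (p 0) < p 1 ∧ p 1 < hi (p 0)})
    (hF1 : ContDiffOn ℝ 1 F C) {t : ℝ} (ht : t ∈ Ioo a b) {y : ℝ} (hy : y ∈ Ioo (lo t) (hi t)) :
    HasDerivAt (fun y : ℝ => F ![t, y]) (fderiv ℝ F ![t, y] (Pi.single 1 1)) y := by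
  have hCo : IsOpen C := by rw [hC]; exact isOpen_cell hlo hhi
  have hp : (![t, y] : Fin 2 → ℝ) ∈ C := by
    rw [hC]; exact ⟨by simpa using ht, by simpa using hy.1, by simpa using hy.2⟩
  have hdiff : DifferentiableAt ℝ F ![t, y] :=
    (hF1.differentiableOn one_ne_zero).differentiableAt (hCo.mem_nhds hp)
  exact hdiff.hasFDerivAt.comp_hasDerivAt y (hasDerivAt_vecCons_snd t y)

/-- **ε = 1:** if `∂_yF > 0` on the cell, `Ψ_F(C) = {t ∈ (a,b), F(t, lo t) < w < F(t, hi t)}`. -/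
theorem image_cell_eq_of_pos {F : (Fin 2 → ℝ) → ℝ} {a b : ℝ} {lo hi : ℝ → ℝ} {C : Set (Fin 2 → ℝ)}
    (hFc : ContinuousOn F Δc) (hlo : ContinuousOn lo (Icc a b)) (hhi : ContinuousOn hi (Icc a b))
    (hlohi : ∀ t ∈ Ioo a b, lo t < hi t)
    (hC : C = {p : Fin 2 → ℝ | p 0 ∈ Ioo a b ∧ lo (p 0) < p 1 ∧ p 1 < hi (p 0)})
    (hCT : C ⊆ To) (hF1 : ContDiffOn ℝ 1 F C)
    (hpos : ∀ p ∈ C, 0 < fderiv ℝ F p (Pi.single 1 1)) :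
    (fun p : Fin 2 → ℝ => (![p 0, F p] : Fin 2 → ℝ)) '' C =
      {q : Fin 2 → ℝ | q 0 ∈ Ioo a b ∧ F ![q 0, lo (q 0)] < q 1 ∧ q 1 < F ![q 0, hi (q 0)]} := by
  -- fibrewise facts
  have hcont : ∀ t ∈ Ioo a b, ContinuousOn (fun y : ℝ => F ![t, y]) (Icc (lo t) (hi t)) := fun t ht =>
    hFc.comp (continuous_vecCons_snd t).continuousOn fun y hy => fibre_subset_triangle hC hCT hlohi ht hy
  have hmono : ∀ t ∈ Ioo a b, StrictMonoOn (fun y : ℝ => F ![t, y]) (Icc (lo t) (hi t)) := by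
    intro t ht
    refine strictMonoOn_of_deriv_pos (convex_Icc _ _) (hcont t ht) fun y hy => ?_
    rw [interior_Icc] at hy
    have hd := hasDerivAt_fibre hlo hhi hC hF1 ht hy
    rw [hd.deriv]
    refine hpos _ ?_
    rw [hC]; exact ⟨by simpa using ht, by simpa using hy.1, by simpa using hy.2⟩
  ext q
  simp only [mem_image, mem_setOf_eq]
  constructor
  · rintro ⟨p, hp, rfl⟩
    have hp' : p 0 ∈ Ioo a b ∧ lo (p 0) < p 1 ∧ p 1 < hi (p 0) := by rw [hC] at hp; exact hp
    obtain ⟨ht, h1, h2⟩ := hp'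
    have hpeq : p = ![p 0, p 1] := by ext i; fin_cases i <;> rfl
    simp only [Matrix.cons_val_zero, Matrix.cons_val_one, Matrix.cons_val_fin_one]
    refine ⟨ht, ?_, ?_⟩
    · have := hmono (p 0) ht (left_mem_Icc.mpr (hlohi _ ht).le) ⟨h1.le, h2.le⟩ h1
      rw [hpeq] at this ⊢; simpa using this
    · have := hmono (p 0) ht ⟨h1.le, h2.le⟩ (right_mem_Icc.mpr (hlohi _ ht).le) h2
      rw [hpeq] at this ⊢; simpa using this
  · rintro ⟨ht, h1, h2⟩
    obtain ⟨y, hy, hyq⟩ := intermediate_value_Ioo (hlohi _ ht).le (hcont (q 0) ht) ⟨h1, h2⟩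
    refine ⟨![q 0, y], ?_, ?_⟩
    · rw [hC]; exact ⟨by simpa using ht, by simpa using hy.1, by simpa using hy.2⟩
    · ext i; fin_cases i
      · simp
      · simpa using hyq

/-- **ε = −1:** if `∂_yF < 0` on the cell, `Ψ_F(C) = {t ∈ (a,b), F(t, hi t) < w < F(t, lo t)}`. -/
theorem image_cell_eq_of_neg {F : (Fin 2 → ℝ) → ℝ} {a b : ℝ} {lo hi : ℝ → ℝ} {C : Set (Fin 2 → ℝ)}
    (hFc : ContinuousOn F Δc) (hlo : ContinuousOn lo (Icc a b)) (hhi : ContinuousOn hi (Icc a b))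
    (hlohi : ∀ t ∈ Ioo a b, lo t < hi t)
    (hC : C = {p : Fin 2 → ℝ | p 0 ∈ Ioo a b ∧ lo (p 0) < p 1 ∧ p 1 < hi (p 0)})
    (hCT : C ⊆ To) (hF1 : ContDiffOn ℝ 1 F C)
    (hneg : ∀ p ∈ C, fderiv ℝ F p (Pi.single 1 1) < 0) :
    (fun p : Fin 2 → ℝ => (![p 0, F p] : Fin 2 → ℝ)) '' C =
      {q : Fin 2 → ℝ | q 0 ∈ Ioo a b ∧ F ![q 0, hi (q 0)] < q 1 ∧ q 1 < F ![q 0, lo (q 0)]} := by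
  have hcont : ∀ t ∈ Ioo a b, ContinuousOn (fun y : ℝ => F ![t, y]) (Icc (lo t) (hi t)) := fun t ht =>
    hFc.comp (continuous_vecCons_snd t).continuousOn fun y hy => fibre_subset_triangle hC hCT hlohi ht hy
  have hanti : ∀ t ∈ Ioo a b, StrictAntiOn (fun y : ℝ => F ![t, y]) (Icc (lo t) (hi t)) := by
    intro t ht
    refine strictAntiOn_of_deriv_neg (convex_Icc _ _) (hcont t ht) fun y hy => ?_
    rw [interior_Icc] at hy
    have hd := hasDerivAt_fibre hlo hhi hC hF1 ht hy
    rw [hd.deriv]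
    refine hneg _ ?_
    rw [hC]; exact ⟨by simpa using ht, by simpa using hy.1, by simpa using hy.2⟩
  ext q
  simp only [mem_image, mem_setOf_eq]
  constructor
  · rintro ⟨p, hp, rfl⟩
    have hp' : p 0 ∈ Ioo a b ∧ lo (p 0) < p 1 ∧ p 1 < hi (p 0) := by rw [hC] at hp; exact hp
    obtain ⟨ht, h1, h2⟩ := hp'
    have hpeq : p = ![p 0, p 1] := by ext i; fin_cases i <;> rfl
    simp only [Matrix.cons_val_zero, Matrix.cons_val_one, Matrix.cons_val_fin_one]
    refine ⟨ht, ?_, ?_⟩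
    · have := hanti (p 0) ht ⟨h1.le, h2.le⟩ (right_mem_Icc.mpr (hlohi _ ht).le) h2
      rw [hpeq] at this ⊢; simpa using this
    · have := hanti (p 0) ht (left_mem_Icc.mpr (hlohi _ ht).le) ⟨h1.le, h2.le⟩ h1
      rw [hpeq] at this ⊢; simpa using this
  · rintro ⟨ht, h1, h2⟩
    -- apply the IVT to `-F` on the fibre
    have hcont' : ContinuousOn (fun y : ℝ => -F ![q 0, y]) (Icc (lo (q 0)) (hi (q 0))) := (hcont _ ht).neg
    obtain ⟨y, hy, hyq⟩ :=
      intermediate_value_Ioo (hlohi _ ht).le hcont' (⟨by simpa using h2, by simpa using h1⟩ :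
        -q 1 ∈ Ioo (-F ![q 0, lo (q 0)]) (-F ![q 0, hi (q 0)]))
    refine ⟨![q 0, y], ?_, ?_⟩
    · rw [hC]; exact ⟨by simpa using ht, by simpa using hy.1, by simpa using hy.2⟩
    · have hyq' : F ![q 0, y] = q 1 := by simpa using hyq
      ext i; fin_cases i
      · simp
      · simpa using hyq'

end DrefuteScratch
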